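import Literature.Probability.RandomPlanarGeometry.CurveSpace
import HarnessLib

/-!
# No idling of the limit interface, part 8: the no-idling dichotomy is a property of the
curve class

Helper file for the registered stub `stub_limitCurveRegularity_noIdle` of line
`hitting-tournament` of crux `LagHandOff` (stmt-CriticalPhenomena-10268).  The stub quantifies
over ALL representatives of the limit class; this file shows that the dichotomy "constant on
`[s, t]`, or leaves the past range `c[0, s]` during `(s, t)`" passes between two curves at
reparametrisation distance `0` (`forall_dichotomy_of_dist_eq_zero`), through the elementary
fact that such curves have the same pairs of consecutive trace segments: for `s ≤ t` there are
`s' ≤ t'` with `c[0, s] = c'[0, s']` and `c[s, t] = c'[s', t']`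
(`exists_image_Icc_eq_of_dist_eq_zero`, two-time form of the tree's
`Curve.exists_image_Iic_eq_of_dist_eq_zero`: subsequential limits of the almost-optimal
reparametrisations at the two times).

References: M. Aizenman, A. Burchard, Duke Math. J. 99 (1999), §2.1 (the space of curves
modulo reparametrisation and its metric).
-/

noncomputable section

open Set Filter Topology Metric
open scoped unitInterval
open Literature.Probability.RandomPlanarGeometry

namespace Summit.CriticalPhenomena.CardyFormulaZ2.Cruxes.LagHandOff.HittingTournament

/-! ### Curves at distance zero: simultaneous identification of two trace segments -/

section DistZero

variable {X : Type*} [MetricSpace X]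

/-- **Trace segments along a subsequence of almost-optimal reparametrisations.** If
`dist (γ r) (γ' (ψ n r)) < 1/(n+1)` for all `r`, and along the subsequence `θ`,
`ψ (θ k) a → a'`, `ψ (θ k) b → b'` (`a ≤ b`), then `γ[a, b] = γ'[a', b']`.
(Aizenman–Burchard 1999, §2.1, the metric.) [folklore] -/
theorem image_Icc_eq_of_tendsto_reparam {γ γ' : Curve X} {ψ : ℕ → I ≃o I}
    (hclose : ∀ n (r : I), dist (γ r) (γ' (ψ n r)) < 1 / ((n : ℝ) + 1))
    {θ : ℕ → ℕ} (hθ : StrictMono θ) {a b a' b' : I} (hab : a ≤ b)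
    (ha : Tendsto (fun k => ψ (θ k) a) atTop (𝓝 a'))
    (hb : Tendsto (fun k => ψ (θ k) b) atTop (𝓝 b')) :
    γ '' Icc a b = γ' '' Icc a' b' := by
  have hγc : Continuous γ := γ.continuous
  have hγ'c : Continuous γ' := γ'.continuous
  have hrate : ∀ {θ' : ℕ → ℕ}, StrictMono θ' →
      Tendsto (fun k ↦ 1 / ((θ' k : ℝ) + 1)) atTop (𝓝 0) := fun {θ'} hθ' ↦
    (tendsto_one_div_add_atTop_nhds_zero_nat (𝕜 := ℝ)).comp hθ'.tendsto_atTop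
  refine Subset.antisymm ?_ ?_
  · rintro _ ⟨r, hr, rfl⟩
    obtain ⟨ρ, φ', hφ', hρ⟩ := CompactSpace.tendsto_subseq fun k ↦ ψ (θ k) r
    have hρa : a' ≤ ρ := le_of_tendsto_of_tendsto' (ha.comp hφ'.tendsto_atTop) hρ
      fun k ↦ (ψ (θ (φ' k))).monotone hr.1
    have hρb : ρ ≤ b' := le_of_tendsto_of_tendsto' hρ (hb.comp hφ'.tendsto_atTop)
      fun k ↦ (ψ (θ (φ' k))).monotone hr.2
    refine ⟨ρ, ⟨hρa, hρb⟩, ?_⟩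
    have h1 : Tendsto (fun k ↦ γ' (ψ (θ (φ' k)) r)) atTop (𝓝 (γ' ρ)) := (hγ'c.tendsto ρ).comp hρ
    have h2 : Tendsto (fun k ↦ γ' (ψ (θ (φ' k)) r)) atTop (𝓝 (γ r)) := by
      refine (tendsto_const_nhds (x := γ r)).congr_dist ?_
      exact squeeze_zero (fun _ ↦ dist_nonneg) (fun k ↦ (hclose (θ (φ' k)) r).le)
        (hrate (hθ.comp hφ'))
    exact tendsto_nhds_unique h1 h2
  · rintro _ ⟨ρ, hρ, rfl⟩
    set r : ℕ → I := fun k ↦ max a (min b ((ψ (θ k)).symm ρ)) with hr_def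
    have hr_mem : ∀ k, r k ∈ Icc a b := fun k ↦ ⟨le_max_left _ _, max_le hab (min_le_left _ _)⟩
    have hψr : ∀ k, ψ (θ k) (r k) = max (ψ (θ k) a) (min (ψ (θ k) b) ρ) := fun k ↦ by
      rw [hr_def]
      dsimp only
      rw [(ψ (θ k)).monotone.map_max, (ψ (θ k)).monotone.map_min, OrderIso.apply_symm_apply]
    obtain ⟨r₀, φ', hφ', hr₀⟩ := CompactSpace.tendsto_subseq r
    have hr₀mem : r₀ ∈ Icc a b :=
      isClosed_Icc.mem_of_tendsto hr₀ (Eventually.of_forall fun k ↦ hr_mem (φ' k))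
    refine ⟨r₀, hr₀mem, ?_⟩
    have h1 : Tendsto (fun k ↦ γ (r (φ' k))) atTop (𝓝 (γ r₀)) := (hγc.tendsto r₀).comp hr₀
    have hlim : Tendsto (fun k ↦ ψ (θ (φ' k)) (r (φ' k))) atTop (𝓝 ρ) := by
      have h3 : Tendsto (fun k ↦ max (ψ (θ (φ' k)) a) (min (ψ (θ (φ' k)) b) ρ)) atTop
          (𝓝 (max a' (min b' ρ))) :=
        (ha.comp hφ'.tendsto_atTop).max ((hb.comp hφ'.tendsto_atTop).min tendsto_const_nhds)
      rw [min_eq_right hρ.2, max_eq_right hρ.1] at h3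
      exact h3.congr fun k ↦ (hψr (φ' k)).symm
    have h2 : Tendsto (fun k ↦ γ (r (φ' k))) atTop (𝓝 (γ' ρ)) := by
      have h3 : Tendsto (fun k ↦ γ' (ψ (θ (φ' k)) (r (φ' k)))) atTop (𝓝 (γ' ρ)) :=
        (hγ'c.tendsto ρ).comp hlim
      refine h3.congr_dist (squeeze_zero (fun _ ↦ dist_nonneg) (fun k ↦ ?_) (hrate (hθ.comp hφ')))
      rw [dist_comm]
      exact (hclose (θ (φ' k)) (r (φ' k))).le
    exact tendsto_nhds_unique h1 h2

/-- **Curves at reparametrisation distance zero have the same pairs of consecutive trace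
segments**: if `dist γ γ' = 0` and `s ≤ t`, then `γ[0, s] = γ'[0, s']` and
`γ[s, t] = γ'[s', t']` for some `s' ≤ t'`. Two-time form of the tree's
`Curve.exists_image_Iic_eq_of_dist_eq_zero`. [folklore] -/
theorem exists_image_Icc_eq_of_dist_eq_zero {γ γ' : Curve X} (h : dist γ γ' = 0) {s t : I}
    (hst : s ≤ t) :
    ∃ s' t' : I, s' ≤ t' ∧ γ '' Icc 0 s = γ' '' Icc 0 s' ∧ γ '' Icc s t = γ' '' Icc s' t' := by
  have hε : ∀ n : ℕ, dist γ γ' < 1 / ((n : ℝ) + 1) := fun n ↦ by rw [h]; positivity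
  choose ψ hψ using fun n ↦ Curve.exists_dist_reparam_lt (hε n)
  have hclose : ∀ n (r : I), dist (γ r) (γ' (ψ n r)) < 1 / ((n : ℝ) + 1) := fun n r ↦ by
    have h1 := ContinuousMap.dist_apply_le_dist (f := γ.toContinuousMap)
      (g := (γ'.reparam (ψ n)).toContinuousMap) (x := r)
    simp only [Curve.coe_toContinuousMap, Curve.reparam_apply] at h1
    exact h1.trans_lt (hψ n)
  obtain ⟨s', φ₁, hφ₁, hs'⟩ := CompactSpace.tendsto_subseq fun n ↦ ψ n s
  obtain ⟨t', φ₂, hφ₂, ht'⟩ := CompactSpace.tendsto_subseq fun k ↦ ψ (φ₁ k) t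
  have hθ : StrictMono (φ₁ ∘ φ₂) := hφ₁.comp hφ₂
  have hs'' : Tendsto (fun k ↦ ψ ((φ₁ ∘ φ₂) k) s) atTop (𝓝 s') := hs'.comp hφ₂.tendsto_atTop
  have ht'' : Tendsto (fun k ↦ ψ ((φ₁ ∘ φ₂) k) t) atTop (𝓝 t') := ht'
  have h0 : Tendsto (fun k ↦ ψ ((φ₁ ∘ φ₂) k) 0) atTop (𝓝 0) := by
    have : (fun k ↦ ψ ((φ₁ ∘ φ₂) k) 0) = fun _ ↦ 0 := funext fun k ↦ (ψ _).map_bot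
    rw [this]
    exact tendsto_const_nhds
  exact ⟨s', t', le_of_tendsto_of_tendsto' hs'' ht'' fun k ↦ (ψ _).monotone hst,
    image_Icc_eq_of_tendsto_reparam hclose hθ unitInterval.nonneg' h0 hs'',
    image_Icc_eq_of_tendsto_reparam hclose hθ hst hs'' ht''⟩

/-- **Openness of avoiding a closed set, towards the left end**: if `c t ∉ F`, `F` closed,
`s < t`, then `c u ∉ F` for some `u ∈ (s, t)`. [folklore] -/
theorem exists_mem_Ioo_notMem {Y : Type*} [TopologicalSpace Y] (c : Curve Y) {F : Set Y}
    (hF : IsClosed F) {s t : I} (hst : s < t) (ht : c t ∉ F) : ∃ u ∈ Ioo s t, c u ∉ F := by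
  have hopen : IsOpen ((c : I → Y) ⁻¹' Fᶜ) := hF.isOpen_compl.preimage c.continuous
  obtain ⟨ε, hε, hball⟩ := Metric.isOpen_iff.1 hopen t ht
  have hst' : (s : ℝ) < t := Subtype.coe_lt_coe.2 hst
  set ur : ℝ := max (((s : ℝ) + t) / 2) (t - ε / 2) with hur
  have hsu : (s : ℝ) < ur := lt_of_lt_of_le (by linarith) (le_max_left _ _)
  have hut : ur < t := max_lt (by linarith) (by linarith)
  have hu0 : 0 ≤ ur := (unitInterval.nonneg s).trans hsu.le
  have hu1 : ur ≤ 1 := hut.le.trans (unitInterval.le_one t)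
  refine ⟨⟨ur, hu0, hu1⟩, ⟨Subtype.coe_lt_coe.1 hsu, Subtype.coe_lt_coe.1 hut⟩, ?_⟩
  have hdist : dist (⟨ur, hu0, hu1⟩ : I) t < ε := by
    rw [Subtype.dist_eq, Real.dist_eq, abs_lt]
    have : (t : ℝ) - ε / 2 ≤ ur := le_max_right _ _
    constructor
    · show -ε < ur - t
      linarith
    · show ur - t < ε
      linarith
  exact hball hdist

/-- **The no-idling dichotomy passes between representatives of one class.** If
`dist c c' = 0` and `c'` satisfies, for all `s' < t'`, "constant on `[s', t']` or leaves
`c'[0, s']` during `(s', t')`", then so does `c`: matching `c[0, s] = c'[0, s']`,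
`c[s, t] = c'[s', t']` (`exists_image_Icc_eq_of_dist_eq_zero`), the case `s' = t'` makes
`c[s, t]` a point, and otherwise a point of `c'[s', t']` off `c'[0, s']` is a point `c u`,
`u ∈ [s, t]`, `u ≠ s`, off `c[0, s]`, moved into `(s, t)` by `exists_mem_Ioo_notMem`.
[folklore] -/
theorem forall_dichotomy_of_dist_eq_zero {c c' : Curve X} (hcc' : dist c c' = 0)
    (h : ∀ s' t' : I, s' < t' →
      (∀ u ∈ Icc s' t', c' u = c' s') ∨ ∃ u ∈ Ioo s' t', c' u ∉ c' '' Icc 0 s') :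
    ∀ s t : I, s < t → (∀ u ∈ Icc s t, c u = c s) ∨ ∃ u ∈ Ioo s t, c u ∉ c '' Icc 0 s := by
  intro s t hst
  obtain ⟨s', t', hs't', h0s, hst'⟩ := exists_image_Icc_eq_of_dist_eq_zero hcc' hst.le
  have hconst_of : (c' '' Icc s' t').Subsingleton → ∀ u ∈ Icc s t, c u = c s := by
    intro hsub u hu
    rw [← hst'] at hsub
    exact hsub (mem_image_of_mem _ hu) (mem_image_of_mem _ (left_mem_Icc.2 hst.le))
  rcases hs't'.eq_or_lt with heq | hlt
  · left
    refine hconst_of ?_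
    rw [← heq, Icc_self, image_singleton]
    exact subsingleton_singleton
  rcases h s' t' hlt with hc' | ⟨u', hu', hnot'⟩
  · left
    refine hconst_of fun x hx y hy => ?_
    obtain ⟨a, ha, rfl⟩ := hx
    obtain ⟨b, hb, rfl⟩ := hy
    rw [hc' a ha, hc' b hb]
  · right
    have hmem : c' u' ∈ c '' Icc s t := by
      rw [hst']
      exact mem_image_of_mem _ ⟨hu'.1.le, hu'.2.le⟩
    obtain ⟨u, hu, hcu⟩ := hmem
    have hcu' : c u ∉ c '' Icc 0 s := by
      rw [hcu, h0s]
      exact hnot'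
    have hus : u ≠ s := by
      rintro rfl
      exact hcu' (mem_image_of_mem _ ⟨unitInterval.nonneg', le_rfl⟩)
    rcases hu.2.eq_or_lt with rfl | hut
    · exact exists_mem_Ioo_notMem c (isClosed_Icc.isCompact.image c.continuous).isClosed hst hcu'
    · exact ⟨u, ⟨lt_of_le_of_ne hu.1 (Ne.symm hus), hut⟩, hcu'⟩

end DistZero

/-- **Registered sub-stub `stub_noIdle_transfer`** (line `hitting-tournament`, stub
`stub_limitCurveRegularity_noIdle`, helper 8): `forall_dichotomy_of_dist_eq_zero` with all
arguments explicit. [folklore] -/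
theorem stub_noIdle_transfer : ∀ (X : Type*) [MetricSpace X] (c c' : Curve X), dist c c' = 0 → (∀ s' t' : unitInterval, s' < t' → (∀ u ∈ Set.Icc s' t', c' u = c' s') ∨ ∃ u ∈ Set.Ioo s' t', c' u ∉ c' '' Set.Icc 0 s') → ∀ s t : unitInterval, s < t → (∀ u ∈ Set.Icc s t, c u = c s) ∨ ∃ u ∈ Set.Ioo s t, c u ∉ c '' Set.Icc 0 s :=
  fun _ _ _ _ hcc' h => forall_dichotomy_of_dist_eq_zero hcc' h

end Summit.CriticalPhenomena.CardyFormulaZ2.Cruxes.LagHandOff.HittingTournament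

end
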